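import Mathlib
import Summits.ValiantsHypothesis.ValiantsHypothesis.Theorems.NewtonUnitEquationsTwoProductsDepthOne

/-!
# Drilling dichotomy of one peeling step

Peel one factor pair of a two-product difference: `D = F·P − G·Q = (F − G)·P + G·(P − Q)`.
Assume `G(0) = P(0) = 1` and let `w` be a strictly positive weight, `wt x = w₀x₀ + w₁x₁`
(so `wt x ≥ 0` with equality iff `x = 0`, by `DepthOne.wt_pos`).  Call a point `x` *light* if
`wt x ≤ wt y` for every `y ∈ supp(F − G) ∪ supp(P − Q)`.

Key computation (`coeff_mul_of_forall_le`): if no monomial of `A` is strictly lighter than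
`x`, then in the Cauchy product for `coeff x (A * P)` (`MvPolynomial.coeff_mul`) a term
`(a, b)` with `A_a ≠ 0` has `wt x = wt a + wt b ≥ wt x + wt b`, forcing `wt b = 0`, `b = 0`;
so only `(x, 0)` survives and `coeff x (A * P) = A_x · P_0`.  Hence for light `x`,
`coeff x D = coeff x (F − G) + coeff x (P − Q)`.

Now let `e` be the strict `w`-minimiser of `supp D`.
* If `e` is light, `0 ≠ coeff e D = coeff e (F − G) + coeff e (P − Q)`, so `e` lies in
  `supp(F − G)` (and is lightest there) or in `supp(P − Q)` (and is lightest there).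
* If `e` is not light, a lightest point `x₀` of `supp(F − G) ∪ supp(P − Q)` is strictly lighter
  than `e`; every light `x` is then strictly lighter than `e`, hence not in `supp D` (strict
  minimality of `e`), i.e. `coeff x (F − G) + coeff x (P − Q) = coeff x D = 0` — the two lightest
  layers coincide and cancel.  In particular `x₀ ∈ supp(F − G)`: otherwise `coeff x₀ (F − G) = 0`
  forces `coeff x₀ (P − Q) = 0`, contradicting `x₀ ∈ supp(P − Q)`.
-/

set_option linter.dupNamespace false

namespace Summit.ValiantsHypothesis.ValiantsHypothesis.Theorems.TwoProducts.DrillingDichotomy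

open MvPolynomial

/-- If no monomial of `A` is strictly `w`-lighter than `x` (positive weights), then in the Cauchy
product for `coeff x (A * P)` only the term `(x, 0)` survives:
`coeff x (A * P) = coeff x A * coeff 0 P`. -/
theorem coeff_mul_of_forall_le (A P : MvPolynomial (Fin 2) ℂ) (w : Fin 2 → ℤ) (hw0 : 0 < w 0)
    (hw1 : 0 < w 1) (x : Fin 2 →₀ ℕ)
    (hx : ∀ a ∈ A.support,
      w 0 * (x 0 : ℤ) + w 1 * (x 1 : ℤ) ≤ w 0 * (a 0 : ℤ) + w 1 * (a 1 : ℤ)) :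
    coeff x (A * P) = coeff x A * coeff 0 P := by
  classical
  have key : ∀ y ∈ Finset.HasAntidiagonal.antidiagonal x, y ≠ (x, (0 : Fin 2 →₀ ℕ)) →
      coeff y.1 A * coeff y.2 P = 0 := by
    intro y hy hyne
    by_cases hyA : coeff y.1 A = 0
    · rw [hyA, zero_mul]
    · exfalso
      rw [Finset.HasAntidiagonal.mem_antidiagonal] at hy
      have h1 := hx y.1 (mem_support_iff.mpr hyA)
      have h2 : w 0 * (x 0 : ℤ) + w 1 * (x 1 : ℤ) = (w 0 * (y.1 0 : ℤ) + w 1 * (y.1 1 : ℤ)) +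
          (w 0 * (y.2 0 : ℤ) + w 1 * (y.2 1 : ℤ)) := by
        rw [← hy]
        simp only [Finsupp.add_apply]
        push_cast
        ring
      have hy2 : y.2 ≠ 0 := by
        intro h
        apply hyne
        have h' : y.1 = x := by rw [← hy, h, add_zero]
        exact Prod.ext h' h
      have h3 := DepthOne.wt_pos w hw0 hw1 y.2 hy2
      linarith
  rw [coeff_mul, Finset.sum_eq_single_of_mem (x, (0 : Fin 2 →₀ ℕ))
    (Finset.HasAntidiagonal.mem_antidiagonal.mpr (add_zero x)) key]

/-- **Drilling dichotomy.**  `G(0) = P(0) = 1`, `w` strictly positive, `e` the strict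
`w`-minimiser of `supp(F·P − G·Q)`.  Then: `e` is a `w`-lightest point of `supp(F − G)`; or `e`
is a `w`-lightest point of `supp(P − Q)`; or some point of `supp(F − G)` is strictly `w`-lighter
than `e` and on the `w`-lightest layer of `supp(F − G) ∪ supp(P − Q)` the coefficients cancel,
`coeff_x(F − G) + coeff_x(P − Q) = 0`. -/
theorem stub_drillingDichotomy : ∀ (F G P Q : MvPolynomial (Fin 2) ℂ),
    MvPolynomial.coeff 0 G = 1 → MvPolynomial.coeff 0 P = 1 →
    ∀ (w : Fin 2 → ℤ), 0 < w 0 → 0 < w 1 → ∀ (e : Fin 2 →₀ ℕ), e ∈ (F * P - G * Q).support →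
    (∀ e' ∈ (F * P - G * Q).support, e' ≠ e →
      w 0 * (e 0 : ℤ) + w 1 * (e 1 : ℤ) < w 0 * (e' 0 : ℤ) + w 1 * (e' 1 : ℤ)) →
    (e ∈ (F - G).support ∧ ∀ x ∈ (F - G).support,
      w 0 * (e 0 : ℤ) + w 1 * (e 1 : ℤ) ≤ w 0 * (x 0 : ℤ) + w 1 * (x 1 : ℤ)) ∨
    (e ∈ (P - Q).support ∧ ∀ x ∈ (P - Q).support,
      w 0 * (e 0 : ℤ) + w 1 * (e 1 : ℤ) ≤ w 0 * (x 0 : ℤ) + w 1 * (x 1 : ℤ)) ∨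
    ((∃ x ∈ (F - G).support,
        w 0 * (x 0 : ℤ) + w 1 * (x 1 : ℤ) < w 0 * (e 0 : ℤ) + w 1 * (e 1 : ℤ)) ∧
      ∀ x ∈ (F - G).support ∪ (P - Q).support,
        (∀ y ∈ (F - G).support ∪ (P - Q).support,
          w 0 * (x 0 : ℤ) + w 1 * (x 1 : ℤ) ≤ w 0 * (y 0 : ℤ) + w 1 * (y 1 : ℤ)) →
        MvPolynomial.coeff x (F - G) + MvPolynomial.coeff x (P - Q) = 0) := by
  intro F G P Q hG0 hP0 w hw0 hw1 e heD hmin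
  classical
  have hD : F * P - G * Q = (F - G) * P + G * (P - Q) := by ring
  -- On light points the two Cauchy products collapse to their constant-term pieces.
  have hlight : ∀ x : Fin 2 →₀ ℕ,
      (∀ y ∈ (F - G).support ∪ (P - Q).support,
        w 0 * (x 0 : ℤ) + w 1 * (x 1 : ℤ) ≤ w 0 * (y 0 : ℤ) + w 1 * (y 1 : ℤ)) →
      coeff x (F * P - G * Q) = coeff x (F - G) + coeff x (P - Q) := by
    intro x hx
    rw [hD, coeff_add, coeff_mul_of_forall_le (F - G) P w hw0 hw1 x
        (fun a ha => hx a (Finset.mem_union_left _ ha)),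
      mul_comm G (P - Q), coeff_mul_of_forall_le (P - Q) G w hw0 hw1 x
        (fun b hb => hx b (Finset.mem_union_right _ hb)), hP0, hG0, mul_one, mul_one]
  by_cases he : ∀ y ∈ (F - G).support ∪ (P - Q).support,
      w 0 * (e 0 : ℤ) + w 1 * (e 1 : ℤ) ≤ w 0 * (y 0 : ℤ) + w 1 * (y 1 : ℤ)
  · -- Case (i): `e` is light, so `coeff e D = coeff e (F - G) + coeff e (P - Q) ≠ 0`.
    have hne : coeff e (F * P - G * Q) ≠ 0 := mem_support_iff.mp heD
    rw [hlight e he] at hne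
    by_cases heA : coeff e (F - G) = 0
    · rw [heA, zero_add] at hne
      exact Or.inr (Or.inl
        ⟨mem_support_iff.mpr hne, fun x hx => he x (Finset.mem_union_right _ hx)⟩)
    · exact Or.inl ⟨mem_support_iff.mpr heA, fun x hx => he x (Finset.mem_union_left _ hx)⟩
  · -- Case (ii): `e` is not light; the lightest layer of `supp(F-G) ∪ supp(P-Q)` cancels.
    push Not at he
    obtain ⟨y, hyU, hylt⟩ := he
    obtain ⟨x₀, hx₀U, hx₀min⟩ : ∃ x₀ ∈ (F - G).support ∪ (P - Q).support,
        ∀ y ∈ (F - G).support ∪ (P - Q).support,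
          w 0 * (x₀ 0 : ℤ) + w 1 * (x₀ 1 : ℤ) ≤ w 0 * (y 0 : ℤ) + w 1 * (y 1 : ℤ) :=
      Finset.exists_min_image _ (fun d => w 0 * (d 0 : ℤ) + w 1 * (d 1 : ℤ)) ⟨y, hyU⟩
    have hx₀lt : w 0 * (x₀ 0 : ℤ) + w 1 * (x₀ 1 : ℤ) < w 0 * (e 0 : ℤ) + w 1 * (e 1 : ℤ) :=
      lt_of_le_of_lt (hx₀min y hyU) hylt
    have hcancel : ∀ x : Fin 2 →₀ ℕ,
        (∀ y ∈ (F - G).support ∪ (P - Q).support,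
          w 0 * (x 0 : ℤ) + w 1 * (x 1 : ℤ) ≤ w 0 * (y 0 : ℤ) + w 1 * (y 1 : ℤ)) →
        coeff x (F - G) + coeff x (P - Q) = 0 := by
      intro x hx
      rw [← hlight x hx]
      by_contra hxD
      have hxlt : w 0 * (x 0 : ℤ) + w 1 * (x 1 : ℤ) < w 0 * (e 0 : ℤ) + w 1 * (e 1 : ℤ) :=
        lt_of_le_of_lt (hx x₀ hx₀U) hx₀lt
      have hxe : x ≠ e := by
        rintro rfl
        exact lt_irrefl _ hxlt
      exact lt_asymm hxlt (hmin x (mem_support_iff.mpr hxD) hxe)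
    refine Or.inr (Or.inr ⟨⟨x₀, ?_, hx₀lt⟩, fun x _ hx => hcancel x hx⟩)
    rcases Finset.mem_union.mp hx₀U with h | h
    · exact h
    · by_contra hx₀A
      have h1 := hcancel x₀ hx₀min
      rw [notMem_support_iff.mp hx₀A, zero_add] at h1
      exact (mem_support_iff.mp h) h1

end Summit.ValiantsHypothesis.ValiantsHypothesis.Theorems.TwoProducts.DrillingDichotomy
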